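import Mathlib
import Summits.ValiantsHypothesis.ValiantsHypothesis.Theses.ImmanantSlice
import Summits.ValiantsHypothesis.ValiantsHypothesis.Theorems.HubHub

/-!
# Route ImmanantSlice — `Assembly` (item stmt-ValiantsHypothesis-4217)

The assembly of route `ImmanantSlice`: `TwoClassRigidity → ValiantsHypothesis`.

Pure bookkeeping. The permanent is the generalized matrix function of the constant class
function `χ ≡ 1` (`per_n = d_1 = ∑_σ C 1 * ∏ᵢ X (σ i, i)`, i.e. `Matrix.permanent` of
`Matrix.mvPolynomialX`). If the permanent family were a `VP` family, `TwoClassRigidity` applied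
to `χ ≡ 1` would give `k, n₀` with `χ(n-cycle) = -χ(type (a, n - a))` for all `n ≥ n₀`, `k < a`,
`k < n - a`; at `n = n₀ + 2k + 4`, `a = k + 2` both cycle types `{n}` and `{a, n - a}` are
realised by permutations of `Fin n` (`Equiv.Perm.exists_with_cycleType_iff`), whence `1 = -1` in
`ℂ` — absurd. So the permanent family over `ℂ` is not a `VP` family, and the landed hub lemma
`Summit.ValiantsHypothesis.Hub.valiantsHypothesis_of_not_isVPFamily_per` (Theorems/HubHub.lean)
together with the bundling bridge `mem_VP_ofFintype_iff_holds` (Bürgisser 2000, Rem. 2.2) and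
Valiant's `perFamily_mem_VNP_holds` (`per ∈ VNP`; Valiant 1979, Bürgisser 2000 Thm. 2.10, both
proved in tree) yields `VP ℂ ≠ VNP ℂ`.

Sources: Valiant 1979; Bürgisser–Clausen–Shokrollahi 1997; Bürgisser 2000.
-/

-- `Summit.<Summit>.<Problem>` repeats `ValiantsHypothesis` by the tree's layout convention (D-0017).
set_option linter.dupNamespace false

namespace Summit.ValiantsHypothesis.ValiantsHypothesis.Theorems

open Literature.Computability.AlgebraicComplexity

/-- The generalized matrix function of the constant coefficient function `χ ≡ 1` on
`Equiv.Perm (Fin n)` is the generic permanent `perPoly (Fin n) ℂ`: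
`∑_σ C 1 * ∏ᵢ X (σ i, i) = per (X_{ij})`. [folklore] -/
theorem immanantSlice_genMatrixFunction_one (n : ℕ) :
    (∑ σ : Equiv.Perm (Fin n), MvPolynomial.C (1 : ℂ) * ∏ i : Fin n, MvPolynomial.X (σ i, i)) =
      perPoly (Fin n) ℂ := by
  simp [perPoly, Matrix.permanent, Matrix.mvPolynomialX]

/-- Under `TwoClassRigidity` the permanent family over `ℂ` is not a `VP` family: the constant
class function `χ ≡ 1` (whose generalized matrix function is `per_n`) takes the same value `1`
on an `n`-cycle and on a permutation of type `(a, n - a)`, while two-class rigidity would force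
these values to be negatives of each other for `n = n₀ + 2k + 4`, `a = k + 2`. [folklore] -/
theorem immanantSlice_not_isVPFamily_per_of_twoClassRigidity
    (h : Summit.ValiantsHypothesis.ValiantsHypothesis.Theses.ImmanantSlice.TwoClassRigidity) :
    ¬ IsVPFamily (fun n => perPoly (Fin n) ℂ) := by
  classical
  intro hfam
  have hper : (fun n => ∑ σ : Equiv.Perm (Fin n),
      MvPolynomial.C ((fun (m : ℕ) (_ : Equiv.Perm (Fin m)) => (1 : ℂ)) n σ) *
        ∏ i : Fin n, MvPolynomial.X (σ i, i)) = fun n => perPoly (Fin n) ℂ := by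
    funext n
    exact immanantSlice_genMatrixFunction_one n
  have hfam' : IsVPFamily (fun n => ∑ σ : Equiv.Perm (Fin n),
      MvPolynomial.C ((fun (m : ℕ) (_ : Equiv.Perm (Fin m)) => (1 : ℂ)) n σ) *
        ∏ i : Fin n, MvPolynomial.X (σ i, i)) := by
    rw [hper]; exact hfam
  obtain ⟨k, n₀, hk⟩ := h (fun (m : ℕ) (_ : Equiv.Perm (Fin m)) => (1 : ℂ))
    (fun _ _ _ _ => rfl) hfam'
  obtain ⟨N, hN⟩ : ∃ N : ℕ, N = n₀ + 2 * k + 4 := ⟨_, rfl⟩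
  have h1 := hk N (by omega) (k + 2) (by omega) (by omega)
  obtain ⟨σ, hσ⟩ : ∃ σ : Equiv.Perm (Fin N), σ.cycleType = {N} :=
    (Equiv.Perm.exists_with_cycleType_iff (Fin N)).2
      ⟨by simp, by simp only [Multiset.mem_singleton, forall_eq]; omega⟩
  obtain ⟨τ, hτ⟩ : ∃ τ : Equiv.Perm (Fin N), τ.cycleType = {k + 2, N - (k + 2)} :=
    (Equiv.Perm.exists_with_cycleType_iff (Fin N)).2
      ⟨by simp only [Multiset.insert_eq_cons, Multiset.sum_cons, Multiset.sum_singleton,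
          Fintype.card_fin]; omega,
       by simp only [Multiset.insert_eq_cons, Multiset.mem_cons, Multiset.mem_singleton]
          rintro a (rfl | rfl) <;> omega⟩
  have h2 := h1 σ τ hσ hτ
  norm_num at h2

/-- **Assembly** (route ImmanantSlice, item `stmt-ValiantsHypothesis-4217`):
`TwoClassRigidity → ValiantsHypothesis`. Two-class rigidity makes the permanent family a
non-`VP` family (`immanantSlice_not_isVPFamily_per_of_twoClassRigidity`, since `per = d_1` and the
classes `(n)`, `(k + 2, n - k - 2)` would have to carry opposite values of the constant function);
the hub lemma `valiantsHypothesis_of_not_isVPFamily_per` with the bundling bridge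
`mem_VP_ofFintype_iff_holds` and Valiant's `perFamily_mem_VNP_holds` gives `VP ℂ ≠ VNP ℂ`.
[folklore] -/
theorem immanantSlice_assembly_proof :
    Summit.ValiantsHypothesis.ValiantsHypothesis.Theses.ImmanantSlice.Assembly := by
  unfold Summit.ValiantsHypothesis.ValiantsHypothesis.Theses.ImmanantSlice.Assembly
  intro hTCR
  exact Summit.ValiantsHypothesis.Hub.valiantsHypothesis_of_not_isVPFamily_per
    (immanantSlice_not_isVPFamily_per_of_twoClassRigidity hTCR)
    (mem_VP_ofFintype_iff_holds _) (perFamily_mem_VNP_holds ℂ)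

end Summit.ValiantsHypothesis.ValiantsHypothesis.Theorems
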